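import Summits.CriticalPhenomena.PercolationContinuityZ3.Theorems.Transplant.SkelPhiKits
import Summits.CriticalPhenomena.PercolationContinuityZ3.Theorems.Transplant.SkelRimDeep
import HarnessLib

/-!
# D″ node, (F) part 5a at φ-level (DPRIME-SCOPE §2 L6′ / p3 addenda L.3, M; hp-8 column): the PER-CONTACT DICHOTOMY of p1-g9's two-scale kit
# clause `Skelφ.kitClause'` for a window step whose enlarged target is a TRUE target plus a RIM (the window-level vertices beyond depth
# `Rt − L''` from the centre) — φ-level successor of `SkelConcKits.hcon_win₂'` (hp-8 g24, p237598/p238137) with the square kit cube and its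
# quarter faces replaced by the band-rectangle kit `rectPrism c (A i) (Rk i)` and its near side `rectU` (p1-g9 `SkelPhiSlabRect`)

builds on p205010 (kernel theorem, internal audit signed; external expert review pending) — nothing in this file uses p205010.
Lane `prim-bschramm`, seat `prim-hp-8` (gen 30; L6′ (F) owner); helper file (`--supports stmt-CriticalPhenomena-4575`).  Hypothesis through the
dictionary: `hstep : Skelφ.Steps G φ` only (nonemptiness of directed sides, the kit centre).  Pure bookkeeping otherwise: the Φ-free
`Skel.deep_or_far` (SkelRimDeep) is imported.
Contacts `x` of the window level `B⟨j⟩` (exploration graph `winGraph G w₀ R`) come in three kinds: FAR (`y x ∉ B_G(w₀, R − r₀)`, face `{y x}`),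
NEAR-RIM (near, but the kit centre `c x = rectCtr …` is not deep: `B_G(c x, Ldeep) ⊄ B_G(w₀, Rt)`; then the whole near side
`rectU … x ⊆ rectPrism (c x) … ⊆ B_G(c x, Rk i)` lies beyond depth `Rt − L''` once `Ldeep + Rk i ≤ L'' ≤ Rt`) and DEEP.  If the target
contains every level vertex beyond depth `Rt − L''` (`hTrim`) and `Rt − L'' ≤ R − r₀`, the first two kinds take the face-in-target branch of
`hcon'`; the deep kind takes the near branch, supplied as the hypothesis `hdeep` (zone / kit-link inputs at the kit centre and the route
datum — for the face step: hp-8's inner band chain, part 5b; for a chain step: p1-g9's `SkelPhiRouteDatum`).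
* §1 `walk_mem_cylBall_of_le`, **`rside_nonempty (hstep)`**, `nearSide_nonempty` (directed sides of a kit rectangle are nonempty, `a_i ≤ R`),
  `rectPrism_subset_graphBall_ctr`;
* §2 **`hcon_rim' (hstep)`** — the dichotomy, conclusion LITERALLY the `hcon'` hypothesis of `Skelφ.kitClause'`.
[cite: KozmaNitzan2024, §4 Lemma 10 Steps III–IV (pp. 19–21), Lemma 11 (p. 22), Lemma 12 (p. 24: edge faces)]
-/

noncomputable section

open MeasureTheory
open scoped Classical

namespace Summit.CriticalPhenomena.PercolationContinuityZ3.Theorems.Transplant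

namespace Skelφ

open Literature.Probability.Percolation Literature.Probability.LatticeModels SimpleGraph KNLevels
open Literature.Barriers.CriticalPhenomena (graphBall graphBall_finite mem_graphBall_self graphBall_mono)
open Skel (winGraph winGraph_adj winGraph_le KitGeom)
open SkelI (tanOff tanTgt tanTgt_mem)
open Literature.Probability.Percolation.KozmaNitzan.Cells (oth oth_ne eq_oth_of_ne oth_oth)

variable {V : Type} [DecidableEq V] {G : SimpleGraph V} [G.LocallyFinite] {φ : V → Site 2}

/-! ## §1 Directed sides are nonempty; the kit rectangle lies in the ball about its centre -/

omit [DecidableEq V] [G.LocallyFinite] in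
/-- The step walk of direction `σ e_i` from `t` stays in the fat prism `cylBall t ℓ k` for `k ≤ ℓ` steps (φ-level twin of
`SkelI.walk_mem_cylBall`). [folklore] -/
theorem walk_mem_cylBall_of_le (hstep : Steps G φ) (t : V) (i : Fin 2) (σ : ℤˣ) {ℓ k : ℕ} (hk : k ≤ ℓ) :
    walk G φ i σ t k ∈ cylBall G φ t ℓ k := by
  induction k with
  | zero => simpa [walk] using self_mem_cylBall G φ t ℓ 0
  | succ k ih =>
    refine mem_cylBall_succ_of_adj G φ t le_rfl (ih (by omega)) (walk_adj hstep i σ t k) ?_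
    rw [mem_cyl, φ_walk hstep, add_sub_cancel_left, mem_box]
    intro i'
    have hσ : (σ : ℤ) = 1 ∨ (σ : ℤ) = -1 := Int.units_eq_one_or σ |>.imp (congrArg _) (congrArg _)
    by_cases hi : i' = i
    · subst hi; simp only [Pi.single_eq_same]; rcases hσ with h | h <;> rw [h] <;> constructor <;> push_cast <;> nlinarith
    · simp only [Pi.single_eq_of_ne hi]; constructor <;> omega

omit [DecidableEq V] in
/-- **Directed sides are nonempty** (from `Steps`): the endpoint of the step walk of `a_i` steps in direction `σ e_i` from the centre lies on the
`(i, σ)`-side of `rectPrism t a R` once `a_i ≤ R`. [cite: KozmaNitzan2024, §4 p. 21 (U(P))] -/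
theorem rside_nonempty (hstep : Steps G φ) (t : V) (a : Fin 2 → ℕ) {R : ℕ} (i : Fin 2) (σ : ℤˣ) (hR : a i ≤ R) :
    (rside G φ t a R i (σ : ℤ)).Nonempty := by
  refine ⟨walk G φ i σ t (a i), ?_⟩
  have hσ : (σ : ℤ) = 1 ∨ (σ : ℤ) = -1 := Int.units_eq_one_or σ |>.imp (congrArg _) (congrArg _)
  rw [mem_rside, mem_rectPrism]
  refine ⟨⟨cylBall_mono G φ t (show a i ≤ amax a from ?_) hR (walk_mem_cylBall_of_le hstep t i σ le_rfl), ?_⟩, ?_⟩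
  · unfold amax; fin_cases i <;> simp
  · rw [φ_walk hstep, add_sub_cancel_left, mem_abox]
    intro i'
    by_cases hi : i' = i
    · subst hi; simp only [Pi.single_eq_same]; rcases hσ with h | h <;> rw [h] <;> constructor <;> nlinarith
    · simp only [Pi.single_eq_of_ne hi]; constructor <;> omega
  · rw [φ_walk hstep]; simp only [Pi.add_apply, Pi.single_eq_same]; ring

omit [DecidableEq V] in
/-- **The near side of a contact's kit rectangle is nonempty** (`A_i ≤ R`). [folklore] -/
theorem nearSide_nonempty (hstep : Steps G φ) (t : V) (i : Fin 2) (σ : ℤˣ) (ℓs : ℕ) (a : Fin 2 → ℕ) {R : ℕ} (hR : a i ≤ R) :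
    (nearSide G hstep t i σ ℓs a R).Nonempty :=
  rside_nonempty hstep _ a i σ hR


omit [DecidableEq V] [G.LocallyFinite] in
/-- The fat rectangle lies in the graph ball of its radius about its centre. [folklore] -/
theorem rectPrism_subset_graphBall_ctr (t : V) (a : Fin 2 → ℕ) (R : ℕ) : rectPrism G φ t a R ⊆ graphBall G t R := fun _ hw =>
  ((mem_prism G φ t R (amax a) _).1 (cylBall_subset_prism G φ t (amax a) R ((mem_rectPrism G φ).1 hw).1)).1

/-! ## §2 The per-contact dichotomy of `kitClause'` for a true target plus a rim -/

variable {types : Finset V} {w₀ : V} {R : ℕ} {lo hi : Site 2} {j ℓs M R' r₀ : ℕ} {A : Fin 2 → Fin 2 → ℕ} {Rk : Fin 2 → ℕ}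

/-- **The per-contact dichotomy `hcon'` of `Skelφ.kitClause'` for a window step with true target + rim** (from `Steps`).  Hypotheses: the near
sides lie in `B⟨j⟩` (`hUsub`, e.g. `(nearFaceOK_rect …).sub`) and are nonempty (`hARk : A i i ≤ Rk i`); every level vertex beyond depth `Rt − L''`
is in the target (`hTrim`); far contacts are rim contacts (`Rt − L'' ≤ R − r₀`); the deepness radius and the kit reach fit in the rim width
(`Ldeep + Rk i ≤ L'' ≤ Rt`); and for DEEP near contacts (`B_G(c x, Ldeep) ⊆ B_G(w₀, Rt)`, `c x` the kit centre) the near-branch conjunction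
(`hdeep`: zone and kit-link inputs at `c x`, and the route datum). The conclusion is literally `kitClause'`'s `hcon'`.
[cite: KozmaNitzan2024, §4 Lemma 10 Step IV (pp. 19–21), Lemma 11 (p. 22), Lemma 12 (p. 24)] -/
theorem hcon_rim' [Countable V] (hstep : Steps G φ) (Λc : V → ℕ → Finset V) {kz n : ℕ} {q : unitInterval} {δ : ℝ}
    {Wt : Sym2 V → unitInterval} {D T : Finset V} {Rt L'' Ldeep : ℕ}
    (hUsub : ∀ x ∈ outerBoundary (winGraph G w₀ R) (winLevel G φ w₀ R lo hi j),
      inNbr G φ w₀ R (Finset.Icc (lo - (j : Site 2)) (hi + (j : Site 2))) x ∈ graphBall G w₀ (R - r₀) →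
        rectU hstep w₀ R lo hi j ℓs M A Rk x ⊆ winLevel G φ w₀ R lo hi j)
    (hARk : ∀ i, A i i ≤ Rk i)
    (hTrim : ∀ v ∈ winLevel G φ w₀ R lo hi j, v ∉ graphBall G w₀ (Rt - L'') → v ∈ T) (hRL : Rt - L'' ≤ R - r₀)
    (hL : ∀ i, Ldeep + Rk i ≤ L'') (hLR : L'' ≤ Rt)
    (hdeep : ∀ x ∈ outerBoundary (winGraph G w₀ R) (winLevel G φ w₀ R lo hi j),
      inNbr G φ w₀ R (Finset.Icc (lo - (j : Site 2)) (hi + (j : Site 2))) x ∈ graphBall G w₀ (R - r₀) →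
      graphBall G (rectCtr hstep (deepCtr G φ w₀ R (lo - (j : Site 2)) (hi + (j : Site 2)) ℓs M x)
            (exitDir G φ w₀ R (lo - (j : Site 2)) (hi + (j : Site 2)) x).1 (exitDir G φ w₀ R (lo - (j : Site 2)) (hi + (j : Site 2)) x).2 ℓs
            (A (exitDir G φ w₀ R (lo - (j : Site 2)) (hi + (j : Site 2)) x).1)) Ldeep ⊆ graphBall G w₀ Rt →
      1 - δ ^ 2 < (bondPercolation G q).real (UniqZone.zone G
          (Λc (rectCtr hstep (deepCtr G φ w₀ R (lo - (j : Site 2)) (hi + (j : Site 2)) ℓs M x)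
            (exitDir G φ w₀ R (lo - (j : Site 2)) (hi + (j : Site 2)) x).1 (exitDir G φ w₀ R (lo - (j : Site 2)) (hi + (j : Site 2)) x).2 ℓs
            (A (exitDir G φ w₀ R (lo - (j : Site 2)) (hi + (j : Site 2)) x).1))) kz n) ∧
        1 - δ ^ 2 < (bondPercolation G q).real (linkIn
          (rectPrism G φ (rectCtr hstep (deepCtr G φ w₀ R (lo - (j : Site 2)) (hi + (j : Site 2)) ℓs M x)
            (exitDir G φ w₀ R (lo - (j : Site 2)) (hi + (j : Site 2)) x).1 (exitDir G φ w₀ R (lo - (j : Site 2)) (hi + (j : Site 2)) x).2 ℓs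
            (A (exitDir G φ w₀ R (lo - (j : Site 2)) (hi + (j : Site 2)) x).1))
            (A (exitDir G φ w₀ R (lo - (j : Site 2)) (hi + (j : Site 2)) x).1) (Rk (exitDir G φ w₀ R (lo - (j : Site 2)) (hi + (j : Site 2)) x).1))
          (Λc (rectCtr hstep (deepCtr G φ w₀ R (lo - (j : Site 2)) (hi + (j : Site 2)) ℓs M x)
            (exitDir G φ w₀ R (lo - (j : Site 2)) (hi + (j : Site 2)) x).1 (exitDir G φ w₀ R (lo - (j : Site 2)) (hi + (j : Site 2)) x).2 ℓs
            (A (exitDir G φ w₀ R (lo - (j : Site 2)) (hi + (j : Site 2)) x).1)) kz)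
          (rectU hstep w₀ R lo hi j ℓs M A Rk x)) ∧
        ∃ Qt Ft : Finset V, Ft ⊆ T ∧ Qt ⊆ D ∧
          Disjoint Ft (Λc (rectCtr hstep (deepCtr G φ w₀ R (lo - (j : Site 2)) (hi + (j : Site 2)) ℓs M x)
            (exitDir G φ w₀ R (lo - (j : Site 2)) (hi + (j : Site 2)) x).1 (exitDir G φ w₀ R (lo - (j : Site 2)) (hi + (j : Site 2)) x).2 ℓs
            (A (exitDir G φ w₀ R (lo - (j : Site 2)) (hi + (j : Site 2)) x).1)) n) ∧
          1 - δ ^ 2 < (prodBernoulli Wt).real (linkIn (↑Qt)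
            (Λc (rectCtr hstep (deepCtr G φ w₀ R (lo - (j : Site 2)) (hi + (j : Site 2)) ℓs M x)
              (exitDir G φ w₀ R (lo - (j : Site 2)) (hi + (j : Site 2)) x).1 (exitDir G φ w₀ R (lo - (j : Site 2)) (hi + (j : Site 2)) x).2 ℓs
              (A (exitDir G φ w₀ R (lo - (j : Site 2)) (hi + (j : Site 2)) x).1)) kz) Ft)) :
    ∀ x ∈ outerBoundary (winGraph G w₀ R) (winLevel G φ w₀ R lo hi j),
      (∃ u ∈ (slabGeomDeep G φ w₀ R lo hi j ℓs M R' r₀ (rectU hstep w₀ R lo hi j ℓs M A Rk)).U x, u ∈ T) ∨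
      (inNbr G φ w₀ R (Finset.Icc (lo - (j : Site 2)) (hi + (j : Site 2))) x ∈ graphBall G w₀ (R - r₀) ∧
        1 - δ ^ 2 < (bondPercolation G q).real (UniqZone.zone G
          (Λc (rectCtr hstep (deepCtr G φ w₀ R (lo - (j : Site 2)) (hi + (j : Site 2)) ℓs M x)
            (exitDir G φ w₀ R (lo - (j : Site 2)) (hi + (j : Site 2)) x).1 (exitDir G φ w₀ R (lo - (j : Site 2)) (hi + (j : Site 2)) x).2 ℓs
            (A (exitDir G φ w₀ R (lo - (j : Site 2)) (hi + (j : Site 2)) x).1))) kz n) ∧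
        1 - δ ^ 2 < (bondPercolation G q).real (linkIn
          (rectPrism G φ (rectCtr hstep (deepCtr G φ w₀ R (lo - (j : Site 2)) (hi + (j : Site 2)) ℓs M x)
            (exitDir G φ w₀ R (lo - (j : Site 2)) (hi + (j : Site 2)) x).1 (exitDir G φ w₀ R (lo - (j : Site 2)) (hi + (j : Site 2)) x).2 ℓs
            (A (exitDir G φ w₀ R (lo - (j : Site 2)) (hi + (j : Site 2)) x).1))
            (A (exitDir G φ w₀ R (lo - (j : Site 2)) (hi + (j : Site 2)) x).1) (Rk (exitDir G φ w₀ R (lo - (j : Site 2)) (hi + (j : Site 2)) x).1))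
          (Λc (rectCtr hstep (deepCtr G φ w₀ R (lo - (j : Site 2)) (hi + (j : Site 2)) ℓs M x)
            (exitDir G φ w₀ R (lo - (j : Site 2)) (hi + (j : Site 2)) x).1 (exitDir G φ w₀ R (lo - (j : Site 2)) (hi + (j : Site 2)) x).2 ℓs
            (A (exitDir G φ w₀ R (lo - (j : Site 2)) (hi + (j : Site 2)) x).1)) kz)
          (rectU hstep w₀ R lo hi j ℓs M A Rk x)) ∧
        ∃ Qt Ft : Finset V, Ft ⊆ T ∧ Qt ⊆ D ∧
          Disjoint Ft (Λc (rectCtr hstep (deepCtr G φ w₀ R (lo - (j : Site 2)) (hi + (j : Site 2)) ℓs M x)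
            (exitDir G φ w₀ R (lo - (j : Site 2)) (hi + (j : Site 2)) x).1 (exitDir G φ w₀ R (lo - (j : Site 2)) (hi + (j : Site 2)) x).2 ℓs
            (A (exitDir G φ w₀ R (lo - (j : Site 2)) (hi + (j : Site 2)) x).1)) n) ∧
          1 - δ ^ 2 < (prodBernoulli Wt).real (linkIn (↑Qt)
            (Λc (rectCtr hstep (deepCtr G φ w₀ R (lo - (j : Site 2)) (hi + (j : Site 2)) ℓs M x)
              (exitDir G φ w₀ R (lo - (j : Site 2)) (hi + (j : Site 2)) x).1 (exitDir G φ w₀ R (lo - (j : Site 2)) (hi + (j : Site 2)) x).2 ℓs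
              (A (exitDir G φ w₀ R (lo - (j : Site 2)) (hi + (j : Site 2)) x).1)) kz) Ft)) := by
  intro x hx
  by_cases hnear : inNbr G φ w₀ R (Finset.Icc (lo - (j : Site 2)) (hi + (j : Site 2))) x ∈ graphBall G w₀ (R - r₀)
  · by_cases hdp : graphBall G (rectCtr hstep (deepCtr G φ w₀ R (lo - (j : Site 2)) (hi + (j : Site 2)) ℓs M x)
            (exitDir G φ w₀ R (lo - (j : Site 2)) (hi + (j : Site 2)) x).1 (exitDir G φ w₀ R (lo - (j : Site 2)) (hi + (j : Site 2)) x).2 ℓs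
            (A (exitDir G φ w₀ R (lo - (j : Site 2)) (hi + (j : Site 2)) x).1)) Ldeep ⊆ graphBall G w₀ Rt
    · exact Or.inr ⟨hnear, hdeep x hx hnear hdp⟩
    · -- near but not deep: the whole near side lies in the rim
      left
      generalize hI : (exitDir G φ w₀ R (lo - (j : Site 2)) (hi + (j : Site 2)) x).1 = I at hdp
      generalize hS : (exitDir G φ w₀ R (lo - (j : Site 2)) (hi + (j : Site 2)) x).2 = sg at hdp
      obtain ⟨u, hu⟩ := nearSide_nonempty hstep (deepCtr G φ w₀ R (lo - (j : Site 2)) (hi + (j : Site 2)) ℓs M x) I sg ℓs (A I) (hARk I)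
      have hUx : (slabGeomDeep G φ w₀ R lo hi j ℓs M R' r₀ (rectU hstep w₀ R lo hi j ℓs M A Rk)).U x = rectU hstep w₀ R lo hi j ℓs M A Rk x := by
        simp only [slabGeomDeep, if_pos hnear]
      have hrect : rectU hstep w₀ R lo hi j ℓs M A Rk x = nearSide G hstep (deepCtr G φ w₀ R (lo - (j : Site 2)) (hi + (j : Site 2)) ℓs M x) I sg ℓs (A I) (Rk I) := by
        rw [rectU, hI, hS]
      have hu' : u ∈ rectU hstep w₀ R lo hi j ℓs M A Rk x := by rw [hrect]; exact hu
      refine ⟨u, by rw [hUx]; exact hu', hTrim u (hUsub x hx hnear hu') fun hub => ?_⟩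
      rcases Skel.deep_or_far G (rectCtr hstep (deepCtr G φ w₀ R (lo - (j : Site 2)) (hi + (j : Site 2)) ℓs M x) I sg ℓs (A I)) (hL I) hLR with h | h
      · exact hdp h
      · refine Set.disjoint_left.1 h ?_ hub
        exact rectPrism_subset_graphBall_ctr (G := G) (φ := φ) _ (A I) (Rk I)
          ((mem_rectPrismFin G φ).1 (nearSide_subset_rectPrismFin hstep _ I sg ℓs (A I) (Rk I) hu))
  · -- far contact: its inner neighbour is a rim vertex
    left
    have hy := inNbr_spec (G := G) (φ := φ) (P := Finset.Icc (lo - (j : Site 2)) (hi + (j : Site 2))) hx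
    have hUx : (slabGeomDeep G φ w₀ R lo hi j ℓs M R' r₀ (rectU hstep w₀ R lo hi j ℓs M A Rk)).U x =
        {inNbr G φ w₀ R (Finset.Icc (lo - (j : Site 2)) (hi + (j : Site 2))) x} := by
      simp only [slabGeomDeep, if_neg hnear]
    refine ⟨inNbr G φ w₀ R (Finset.Icc (lo - (j : Site 2)) (hi + (j : Site 2))) x, by rw [hUx]; exact Finset.mem_singleton_self _,
      hTrim _ ?_ fun hyb => hnear (graphBall_mono G w₀ hRL hyb)⟩
    rw [mem_winLevel_iff]
    exact ⟨hy.2.1, hy.2.2⟩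

end Skelφ

end Summit.CriticalPhenomena.PercolationContinuityZ3.Theorems.Transplant

end
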